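import Summits.QuantumFields.BalabanUV.Beta.GAN24.W3TowerOfZS
import Summits.QuantumFields.BalabanUV.Beta.GAN24.WSlotT2DriftFromOneThree
import Summits.QuantumFields.BalabanUV.Beta.GAN24.WSlotSourceZeroModeHolds

/-!
# `BalabanUV.Beta.GAN24.W3PinCountdown` — binder row G-an2-4 / (CONV-C), W-slot road «W3» (gan24-p1-g5 `SKELETON-W3.md` v1.0.2 §8.3∕§8.4; ENDs
# `WSlotT2OfPieces` p213240): **THE COUNTDOWN AT an1's TABLES REACHES THE PIN — «T2Shape» ∧ «T2Drift» (both repair currencies of record) AND THE D1 WALL's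
# W-PAIR `(hW₂, hW₂all)` FOR an2's NORMALISED STAGE-B FAMILY WITH an1's MIXED TABLE, d = 3, Lc ≥ 2, FROM THE EXACT PIN `cE₂ = +Lc^{2(3+1)}` ALONE:
# ROW W3-F2a IS DISCHARGED BY leaf-20's `WSlotSourceZeroModeHolds.zfree_bracket_an1`** (G-an2-4 formalisation swarm, leaf prover 08 = the ROW W3-F4a∕F4b
# lineage, gen 20; journal l.10821∕COURIER-CLAIM l.11035; module name PROVISIONAL)

NOT IN PRINT; OUR PROOF ([folklore] composition BY NAME, zero analytic content added).  A SOCKET∕COUNTDOWN CERTIFICATE, NOT THE §8.4 HEADLINE: END #3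
`WSlotT2Tables`, the W-slot's closing sentence and the (D1) identification are the row OWNER's (gan24-p1) — absorb ∕ rename at will.  HONEST FRAMING (cell
contract, verbatim): «discharging `BetaPertH` makes Bałaban's UV stability UNCONDITIONAL — a real constructive-QFT result; it is NOT the continuum limit and
NOT the Clay problem.»  HONEST DEPENDENCY (verbatim): «continuum YM on T⁴ ⇐ BetaPertH ∧ nine spine estimates (0/9 proved); BetaPertH ⇐ (D1) ∧ (D4) ∧
CAP+tail; G-an2-4 gates asym, D1 and NE2/3/4.»

PLUGS (all BY NAME, tree theorems): ROW W3-F2a at an1's tables = leaf-20-g18's `WSlotSourceZeroModeHolds.zfree_bracket_base` ∕ `hZ_cell_base` (p215354: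
the `Zfree` of record — jointly `Lc`-covariant ∧ cell ff zero mode — for leaf-04's literal bracket at the ENDs' base root `vh₂S 3 Lc` with an1's
`mixFFAt (toSite r) Lc`; its channel inputs are leaf-06-g9's `ResponseExchangeStep` ∕ `ChannelBondLegs` ∕ `SecondResponseZeroMode` ∕ `ExchangeZeroMode`); the (R3′) pair =
THIS lineage's `W3TowerOfZS.t2ShapeDrift_three_an1_of_F2acell_pinEq` (END #1 leaf-12, END #2 as typed at `Zfree := ZfreeSym` — ref2 R63-1's composition of
record; F4d's pin half by leaf-12's `FirstDiffSymCharge`); the (R1) drift and the W-pair = leaf-18-g18's `WSlotT2DriftFromOneThree.t2Drift_three_of_F2a_pinEq` ∕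
`hW_hWall_three_of_F2a_pinEq` (END #2′ from `D♮₁`, `ChargeStepSymD1`; wall socket `WSlotCauchyThree.hW_hWall_three_of_T2ShapeDrift`).

WHAT (`d = 3`, `2 ≤ Lc`, `r ∈ box (3+1) Lc`, EXACT pin; `T♮_j`, `b♮_m` the LITERAL §8.3 texts at `vh₂S 3 Lc` ∕ `mixFFAt (toSite r) Lc`):
* **`t2ShapeDrift_three_an1_of_pinEq (hLc) (hr) (cE cVH cΛ cE₂ cB) (Tc) (hpinEq)`** — «T2Shape» ∧ «T2Drift» ((R3′) currency) from the exact pin ALONE.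
* **`t2Drift_three_an1_of_pinEq_fromOne`** — «T2Drift» by the (R1) chain (END #2′) from the exact pin ALONE (kernel-interchangeable with the (R3′) drift,
  cf. leaf-11-g20's probe P2 l.10909).
* **`hW_hWall_three_an1_of_pinEq`** — the D1 wall's W-PAIR (`hW₂` uniform row ∧ `hW₂all` Cauchy row, ref2 r61 §D's literal text) from the exact pin ALONE
  ((R3′) pair ⨾ wall socket); **`hW_hWall_three_an1_of_pinEq_fromOne`** — the same by leaf-18-g18's (R1) chain.
HONEST: the EXACT pin `cE₂ = +Lc^{2(3+1)}` (an2's (P6); sign of record ref2 R55-3; ref2 R63 §C: LOAD-BEARING — at an3's `w22 N` it is NECESSARY) is the ONE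
remaining hypothesis and is UNDISCHARGED; the window ∕ `hW′` ∕ the (D1) identification are untouched; W wall binders stay 0∕2 by the referee's rule until the
pin is a tree theorem or the route's declared open binder (wall binders: K 2∕2, S 2∕2 are tree theorems at d = 3, Lc ≥ 2, W 0∕2 — this module: reduction to
the pin only); «T2Shape»∕«T2SupRate»∕«T2Drift» as statements about Bałaban's construction remain NOT IN PRINT; NOT «W-slot closed» — never under an
undischarged pin; NEVER «G-an2-4 closed», NOT (CONV-C); NOT `BetaPertH`, NOT continuum, NOT Clay.  0 cited facts, 0 `def`, 0 `def … : Prop`, 0 sorry.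
Unit `b2b-balaban-gan24-formalise-leaf-08` (G-an2-4 formalisation swarm, leaf prover 08, gen 20), 2026-08-20.
-/

noncomputable section

open Literature.MathematicalPhysics.QuantumFieldTheory
open Literature.MathematicalPhysics.QuantumFieldTheory.Balaban1983to89
open Literature.MathematicalPhysics.QuantumFieldTheory.Balaban1983to89.Beta
open AffineAveraging (box toSite)
open ExpKernelCalculus (MKer VertexFamily₂ shiftK)
open OneStepResolventKernel (Fib)
open OneStepKernelFamily (KInvStep)
open StepJetData (mfNeg)
open SecondOrderResponse (W2SymOfK LocStencilFM)
open BalabanCompositeJets (LocStencil₂)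
open BalabanStepJetsSucc (mmRead)
open BalabanStepW2 (K3OfK Spure M1 M2Of T2Of WbalOf)
open AveragingMixedJetTables (vh₂S mixFFAt)
open Summit.QuantumFields.BalabanUV.Beta.HessKerDressedUnits (unitK unitS unitW)
open Summit.QuantumFields.BalabanUV.Beta.SecondOrderUnits (unitM unitS₂ unitM₂)
open Summit.QuantumFields.BalabanUV.Beta.GAN24.CombesThomas (sfStep smStep)
open Summit.QuantumFields.BalabanUV.Beta.GAN24.StencilSlotOfE3 (one_le_of_two_le)
open Summit.QuantumFields.BalabanUV.Beta.GAN24.BiStencilZeroMode (zmode)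
open Summit.QuantumFields.BalabanUV.Beta.GAN24.T2RecursionAffine (lin4)
open Summit.QuantumFields.BalabanUV.Beta.GAN24.WSlotSourceZeroModeHolds (zfree_bracket_base hZ_cell_base)
open Summit.QuantumFields.BalabanUV.Beta.GAN24.W3TowerOfZS (t2ShapeDrift_three_an1_of_F2acell_pinEq)
open Summit.QuantumFields.BalabanUV.Beta.GAN24.WSlotT2DriftFromOneThree (t2Drift_three_of_F2a_pinEq hW_hWall_three_of_F2a_pinEq)
open Summit.QuantumFields.BalabanUV.Beta.MixedJetTablesPlug (hmix_an1)
open Summit.QuantumFields.BalabanUV.Beta.GAN24.WSlotMixedShape (mixFFAt_hfm mixFFAt_hm)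
open Summit.QuantumFields.BalabanUV.Beta.GAN24.WSlotCauchyThree (hW_hWall_three_of_T2ShapeDrift)

namespace Summit.QuantumFields.BalabanUV.Beta.GAN24.W3PinCountdown

variable {Lc : ℕ} [NeZero Lc] {r : Fin (3 + 1) → ℕ}

/-- **«T2Shape» ∧ «T2Drift» AT an1's TABLE FROM THE EXACT PIN ALONE** ((R3′) currency of record, ref2 R63-1) [folklore composition:
`W3TowerOfZS.t2ShapeDrift_three_an1_of_F2acell_pinEq` with ROW W3-F2a := leaf-20-g18's `WSlotSourceZeroModeHolds.hZ_cell_base` (p215354)]: `d = 3`, `2 ≤ Lc`, `r ∈ box (3+1) Lc`,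
`cE₂ = +Lc^{2(3+1)}`, every other colour constant and the colour tensor `Tc` symbolic. -/
theorem t2ShapeDrift_three_an1_of_pinEq (hLc : 2 ≤ Lc) (hr : r ∈ box (3 + 1) Lc) (cE cVH cΛ cE₂ cB : ℝ)
    (Tc : Fin 4 → Fin 4 → Fin 4 → Fin 4 → ℝ) (hpinEq : cE₂ = (Lc : ℝ) ^ (2 * (3 + 1))) :
    (∃ C₂ δ₂ : ℝ, 0 < δ₂ ∧ ∀ j, LocStencil₂ (unitS₂ (sfStep Lc j) (smStep 3 Lc j) (T2Of 3 Lc cE cVH cΛ cE₂ cB Tc (vh₂S 3 Lc) (mixFFAt (toSite r) Lc) j)) C₂ δ₂) ∧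
    (∃ c ϑ δT : ℝ, 0 ≤ c ∧ 0 < ϑ ∧ ϑ < 1 ∧ 0 < δT ∧
      (∀ n, LocStencil₂ (fun κ u κ' u' => unitS₂ (sfStep Lc (n + 1)) (smStep 3 Lc (n + 1)) (T2Of 3 Lc cE cVH cΛ cE₂ cB Tc (vh₂S 3 Lc) (mixFFAt (toSite r) Lc) (n + 1)) κ u κ' u' - unitS₂ (sfStep Lc n) (smStep 3 Lc n) (T2Of 3 Lc cE cVH cΛ cE₂ cB Tc (vh₂S 3 Lc) (mixFFAt (toSite r) Lc) n) κ u κ' u') (c * ϑ ^ n) δT) ∧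
      (∀ k j, LocStencil₂ (fun κ u κ' u' => unitS₂ (sfStep Lc (k + j)) (smStep 3 Lc (k + j)) (T2Of 3 Lc cE cVH cΛ cE₂ cB Tc (vh₂S 3 Lc) (mixFFAt (toSite r) Lc) (k + j)) κ u κ' u' - unitS₂ (sfStep Lc k) (smStep 3 Lc k) (T2Of 3 Lc cE cVH cΛ cE₂ cB Tc (vh₂S 3 Lc) (mixFFAt (toSite r) Lc) k) κ u κ' u') (c * (1 - ϑ)⁻¹ * ϑ ^ k) δT) ∧
      (∀ n κ u κ' u' x z a b, |unitS₂ (sfStep Lc (n + 1)) (smStep 3 Lc (n + 1)) (T2Of 3 Lc cE cVH cΛ cE₂ cB Tc (vh₂S 3 Lc) (mixFFAt (toSite r) Lc) (n + 1)) κ u κ' u' x z a b - unitS₂ (sfStep Lc n) (smStep 3 Lc n) (T2Of 3 Lc cE cVH cΛ cE₂ cB Tc (vh₂S 3 Lc) (mixFFAt (toSite r) Lc) n) κ u κ' u' x z a b| ≤ c * ϑ ^ n)) :=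
  t2ShapeDrift_three_an1_of_F2acell_pinEq hLc hr cE cVH cΛ cE₂ cB Tc hpinEq
    (hZ_cell_base (d := 3) (one_le_of_two_le hLc) hr cE cVH cΛ cE₂ cB)

/-- **«T2Drift» AT an1's TABLE FROM THE EXACT PIN ALONE BY THE (R1) CHAIN** [folklore composition: leaf-18-g18's END #2′
`WSlotT2DriftFromOneThree.t2Drift_three_of_F2a_pinEq` with ROW W3-F2a := leaf-20's `zfree_bracket_base` (both conjuncts of the record `Zfree`, base root)]. -/
theorem t2Drift_three_an1_of_pinEq_fromOne (hLc : 2 ≤ Lc) (hr : r ∈ box (3 + 1) Lc) (cE cVH cΛ cE₂ cB : ℝ)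
    (Tc : Fin 4 → Fin 4 → Fin 4 → Fin 4 → ℝ) (hpinEq : cE₂ = (Lc : ℝ) ^ (2 * (3 + 1))) :
    ∃ c ϑ δT : ℝ, 0 ≤ c ∧ 0 < ϑ ∧ ϑ < 1 ∧ 0 < δT ∧
      (∀ n, LocStencil₂ (fun κ u κ' u' => unitS₂ (sfStep Lc (n + 1)) (smStep 3 Lc (n + 1)) (T2Of 3 Lc cE cVH cΛ cE₂ cB Tc (vh₂S 3 Lc) (mixFFAt (toSite r) Lc) (n + 1)) κ u κ' u' - unitS₂ (sfStep Lc n) (smStep 3 Lc n) (T2Of 3 Lc cE cVH cΛ cE₂ cB Tc (vh₂S 3 Lc) (mixFFAt (toSite r) Lc) n) κ u κ' u') (c * ϑ ^ n) δT) ∧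
      (∀ k j, LocStencil₂ (fun κ u κ' u' => unitS₂ (sfStep Lc (k + j)) (smStep 3 Lc (k + j)) (T2Of 3 Lc cE cVH cΛ cE₂ cB Tc (vh₂S 3 Lc) (mixFFAt (toSite r) Lc) (k + j)) κ u κ' u' - unitS₂ (sfStep Lc k) (smStep 3 Lc k) (T2Of 3 Lc cE cVH cΛ cE₂ cB Tc (vh₂S 3 Lc) (mixFFAt (toSite r) Lc) k) κ u κ' u') (c * (1 - ϑ)⁻¹ * ϑ ^ k) δT) ∧
      (∀ n κ u κ' u' x z a b, |unitS₂ (sfStep Lc (n + 1)) (smStep 3 Lc (n + 1)) (T2Of 3 Lc cE cVH cΛ cE₂ cB Tc (vh₂S 3 Lc) (mixFFAt (toSite r) Lc) (n + 1)) κ u κ' u' x z a b - unitS₂ (sfStep Lc n) (smStep 3 Lc n) (T2Of 3 Lc cE cVH cΛ cE₂ cB Tc (vh₂S 3 Lc) (mixFFAt (toSite r) Lc) n) κ u κ' u' x z a b| ≤ c * ϑ ^ n) :=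
  t2Drift_three_of_F2a_pinEq hLc hr cE cVH cΛ cE₂ cB Tc hpinEq
    (zfree_bracket_base (d := 3) (one_le_of_two_le hLc) hr cE cVH cΛ cE₂ cB)

/-- **THE D1 WALL's W-PAIR AT an1's TABLE FROM THE EXACT PIN ALONE, (R3′) chain of record** — `hW₂` (uniform `VertexFamily₂` row) ∧ `hW₂all`
(Cauchy row) for an2's normalised Stage-B family `unitW_j (WbalOf 3 Lc cE cVH cΛ (T2Of …) (mixFFAt (toSite r) Lc) j)`, ref2 r61 §D's literal text
[folklore composition: `t2ShapeDrift_three_an1_of_pinEq` ⨾ the wall socket `WSlotCauchyThree.hW_hWall_three_of_T2ShapeDrift` (leaf-07∕owner), rates merged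
at `min δ₂ δT` by `LocStencil₂.mono`, ROWS-MIX by `hmix_an1`∕`mixFFAt_hfm`∕`mixFFAt_hm` — the 6-line glue of leaf-18-g18's §3 ∕ leaf-14-g25's P3].  The pin is
the ONE hypothesis left; it is UNDISCHARGED (an2's (P6)) — NOT «W-slot closed». -/
theorem hW_hWall_three_an1_of_pinEq (hLc : 2 ≤ Lc) (hr : r ∈ box (3 + 1) Lc) (cE cVH cΛ cE₂ cB : ℝ)
    (Tc : Fin 4 → Fin 4 → Fin 4 → Fin 4 → ℝ) (hpinEq : cE₂ = (Lc : ℝ) ^ (2 * (3 + 1))) :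
    ∃ Cw cW θW δW : ℝ, 0 ≤ θW ∧ θW < 1 ∧ 0 < δW ∧
      (∀ j, VertexFamily₂ (unitW (sfStep Lc j) (smStep 3 Lc j)
        (WbalOf 3 Lc cE cVH cΛ (T2Of 3 Lc cE cVH cΛ cE₂ cB Tc (vh₂S 3 Lc) (mixFFAt (toSite r) Lc)) (mixFFAt (toSite r) Lc) j)) Lc Cw δW) ∧
      (∀ k j, VertexFamily₂ (unitW (sfStep Lc (k + j)) (smStep 3 Lc (k + j))
        (WbalOf 3 Lc cE cVH cΛ (T2Of 3 Lc cE cVH cΛ cE₂ cB Tc (vh₂S 3 Lc) (mixFFAt (toSite r) Lc)) (mixFFAt (toSite r) Lc) (k + j)) -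
        unitW (sfStep Lc k) (smStep 3 Lc k)
        (WbalOf 3 Lc cE cVH cΛ (T2Of 3 Lc cE cVH cΛ cE₂ cB Tc (vh₂S 3 Lc) (mixFFAt (toSite r) Lc)) (mixFFAt (toSite r) Lc) k)) Lc (cW * θW ^ k) δW) := by
  obtain ⟨CM₂, δ₄, hδ₄, hmixL⟩ := hmix_an1 (d := 3) (Lc := Lc) (one_le_of_two_le hLc) hr
  obtain ⟨⟨C₂, δ₂, hδ₂, hx⟩, c, ϑ, δT, -, hϑ0, hϑ1, hδT, -, hCau, -⟩ :=
    t2ShapeDrift_three_an1_of_pinEq hLc hr cE cVH cΛ cE₂ cB Tc hpinEq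
  exact hW_hWall_three_of_T2ShapeDrift hLc cE cVH cΛ
    (T₂ := T2Of 3 Lc cE cVH cΛ cE₂ cB Tc (vh₂S 3 Lc) (mixFFAt (toSite r) Lc)) (δ₂ := min δ₂ δT)
    (fun j => (hx j).mono (min_le_left _ _))
    (fun k j => ((hCau k j).mono (min_le_right _ _)))
    (lt_min hδ₂ hδT) hϑ0.le hϑ1 hmixL hδ₄ (mixFFAt_hfm (toSite r)) (mixFFAt_hm (toSite r))

/-- **THE SAME W-PAIR BY THE (R1) CHAIN** — `hW₂` ∧ `hW₂all` for an2's normalised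
Stage-B family `unitW_j (WbalOf 3 Lc cE cVH cΛ (T2Of …) (mixFFAt (toSite r) Lc) j)`, ref2 r61 §D's literal text [folklore composition: leaf-18-g18's
`WSlotT2DriftFromOneThree.hW_hWall_three_of_F2a_pinEq` (wall socket `WSlotCauchyThree.hW_hWall_three_of_T2ShapeDrift` inside) with ROW W3-F2a := leaf-20's
`zfree_bracket_base`].  The pin is the ONE hypothesis left; it is UNDISCHARGED (an2's (P6)) — NOT «W-slot closed». -/
theorem hW_hWall_three_an1_of_pinEq_fromOne (hLc : 2 ≤ Lc) (hr : r ∈ box (3 + 1) Lc) (cE cVH cΛ cE₂ cB : ℝ)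
    (Tc : Fin 4 → Fin 4 → Fin 4 → Fin 4 → ℝ) (hpinEq : cE₂ = (Lc : ℝ) ^ (2 * (3 + 1))) :
    ∃ Cw cW θW δW : ℝ, 0 ≤ θW ∧ θW < 1 ∧ 0 < δW ∧
      (∀ j, VertexFamily₂ (unitW (sfStep Lc j) (smStep 3 Lc j)
        (WbalOf 3 Lc cE cVH cΛ (T2Of 3 Lc cE cVH cΛ cE₂ cB Tc (vh₂S 3 Lc) (mixFFAt (toSite r) Lc)) (mixFFAt (toSite r) Lc) j)) Lc Cw δW) ∧
      (∀ k j, VertexFamily₂ (unitW (sfStep Lc (k + j)) (smStep 3 Lc (k + j))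
        (WbalOf 3 Lc cE cVH cΛ (T2Of 3 Lc cE cVH cΛ cE₂ cB Tc (vh₂S 3 Lc) (mixFFAt (toSite r) Lc)) (mixFFAt (toSite r) Lc) (k + j)) -
        unitW (sfStep Lc k) (smStep 3 Lc k)
        (WbalOf 3 Lc cE cVH cΛ (T2Of 3 Lc cE cVH cΛ cE₂ cB Tc (vh₂S 3 Lc) (mixFFAt (toSite r) Lc)) (mixFFAt (toSite r) Lc) k)) Lc (cW * θW ^ k) δW) :=
  hW_hWall_three_of_F2a_pinEq hLc hr cE cVH cΛ cE₂ cB Tc hpinEq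
    (zfree_bracket_base (d := 3) (one_le_of_two_le hLc) hr cE cVH cΛ cE₂ cB)

end Summit.QuantumFields.BalabanUV.Beta.GAN24.W3PinCountdown

end
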